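import Summits.BirchSwinnertonDyer.BirchSwinnertonDyer.Theorems.Rank2ObservatoryRank3TamagawaValues
import Summits.BirchSwinnertonDyer.BirchSwinnertonDyer.Theorems.Rank2ObservatoryRank3TorsionValues
import Summits.BirchSwinnertonDyer.BirchSwinnertonDyer.Theorems.Rank2ObservatoryRank3ConductorTotal
import Summits.BirchSwinnertonDyer.BirchSwinnertonDyer.Theorems.Rank2ObservatoryRank3MinimalTotal
import Summits.BirchSwinnertonDyer.BirchSwinnertonDyer.Theorems.Rank2ObservatoryRank3KernelCertsCensus
import HarnessLib

/-!
# BirchSwinnertonDyer — rank ≥ 2 observatory: the ALGEBRAIC BSD DATA of every rank-3 census row in one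
# theorem (global minimality, conductor, three independent points, torsion order, Tamagawa product)

HONEST FRAMING: per-curve certified theorems and census instruments; no claim on BSD in rank ≥ 2.

A packaging leaf with NO data, NO definition, NO named fact and NO hypothesis beyond the row index: for
every `i < 9487`, the census equation `E = rank3Table[i]` (Cremona's model of a rank-3 curve of conductor
`< 500 000`) satisfies, as KERNEL-CERTIFIED theorems of the tree assembled from five instruments of unit
`b2b-bsdr2-cert-2`,
* `E` is a global minimal Weierstrass equation (`Rank3Row.isGloballyMinimal_of_mem`, Kraus / Silverman
  certificates, `Rank2ObservatoryRank3MinimalTotal`);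
* `N_E = N` (`Rank3Row.conductorNorm_eq_getElem`, Tate certificates, `Rank2ObservatoryRank3ConductorTotal`);
* `3 ≤ rank_ℤ E(ℚ)` (`Rank3Row.three_le_rank_kernel`, three-point coset certificates,
  `Rank2ObservatoryRank3KernelCertsCensus`);
* `#E(ℚ)_tors = rank3TorsValues[i]` (`torsionOrder_eq_getElem`, `Rank2ObservatoryRank3TorsionValues`);
* `∏_v c_v = rank3TamValues[i]` (`Tam.tamagawaProduct_eq_getElem`, `Rank2ObservatoryRank3TamagawaValues`).
So the algebraic side of the BSD formula of each census curve — everything except the period, the regulator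
and `#Ш` — is available to downstream files from ONE lemma, `Rank3Row.algebraicData_getElem`, by table
lookup.  (The root number `w(E) = −1` of every row is `Rank3Row.rootNumber_eq_neg_one_of_mem`, kernel values
modulo the named local-root-number dictionary, and is deliberately not bundled here.)
References: [Silverman1994] J. H. Silverman, *Advanced Topics in the Arithmetic of Elliptic Curves*, GTM 151
(1994), IV.9; [SilvermanAEC2009] J. H. Silverman, *The Arithmetic of Elliptic Curves*, 2nd ed. (2009),
VII.3.1, VIII.7; [CremonaAlgorithms1997] J. E. Cremona, *Algorithms for Modular Elliptic Curves*, 2nd ed.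
(1997), §3 and Tables.
-/

set_option linter.dupNamespace false
set_option autoImplicit false

namespace Summit.BirchSwinnertonDyer.BirchSwinnertonDyer.Rank2Observatory

/-- **ONE-STOP ALGEBRAIC BSD DATA of row `i` of the rank-3 table (NO named fact, NO hypothesis)**: global
minimality, conductor, three independent rational points, torsion order and Tamagawa product, each a kernel
theorem of the tree. [cite: Silverman1994, IV.9.4] [cite: SilvermanAEC2009, Prop. VII.3.1(b)]
[cite: CremonaAlgorithms1997, Tables] -/
theorem Rank3Row.algebraicData_getElem (i : ℕ) (hi : i < rank3Table.length) :
    (rank3Table[i]'hi).curve.IsGloballyMinimal ∧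
      (rank3Table[i]'hi).curve.conductorNorm ℤ = (rank3Table[i]'hi).N ∧
      3 ≤ (rank3Table[i]'hi).curve.mordellWeilRank ∧
      (rank3Table[i]'hi).curve.torsionOrder =
        rank3TorsValues[i]'(by rw [rank3TorsValues_length, ← rank3Table_length]; exact hi) ∧
      (rank3Table[i]'hi).curve.tamagawaProduct =
        Tam.rank3TamValues[i]'(by rw [Tam.rank3TamValues_length, ← rank3Table_length]; exact hi) :=
  ⟨Rank3Row.isGloballyMinimal_of_mem (List.getElem_mem hi), Rank3Row.conductorNorm_eq_getElem i hi,
    Rank3Row.three_le_rank_kernel (List.getElem_mem hi), torsionOrder_eq_getElem i hi,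
    Tam.tamagawaProduct_eq_getElem i hi⟩

/-- Membership form of `Rank3Row.algebraicData_getElem` for the three index-free components.
[cite: Silverman1994, IV.9.4] -/
theorem Rank3Row.algebraicData_of_mem {r : Rank3Row} (hr : r ∈ rank3Table) :
    r.curve.IsGloballyMinimal ∧ r.curve.conductorNorm ℤ = r.N ∧ 3 ≤ r.curve.mordellWeilRank :=
  ⟨Rank3Row.isGloballyMinimal_of_mem hr, Rank3Row.conductorNorm_eq_of_mem hr, Rank3Row.three_le_rank_kernel hr⟩

set_option maxHeartbeats 2000000 in
/-- Worked example (row `7507`, `431613a2`): minimal, `N_E = 431613`, `3 ≤ rank_ℤ`, `#E(ℚ)_tors = 2`,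
`∏_v c_v = 576`. [cite: CremonaAlgorithms1997, Tables] -/
theorem algebraicData_431613a2 :
    (rank3Table[7507]'(by rw [rank3Table_length]; decide)).curve.IsGloballyMinimal ∧
      (rank3Table[7507]'(by rw [rank3Table_length]; decide)).curve.conductorNorm ℤ = 431613 ∧
      3 ≤ (rank3Table[7507]'(by rw [rank3Table_length]; decide)).curve.mordellWeilRank ∧
      (rank3Table[7507]'(by rw [rank3Table_length]; decide)).curve.torsionOrder = 2 ∧
      (rank3Table[7507]'(by rw [rank3Table_length]; decide)).curve.tamagawaProduct = 576 := by
  obtain ⟨h1, h2, h3, h4, h5⟩ := Rank3Row.algebraicData_getElem 7507 (by rw [rank3Table_length]; decide)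
  refine ⟨h1, ?_, h3, ?_, ?_⟩
  · rw [h2]; decide +kernel
  · rw [h4]; decide +kernel
  · rw [h5]; decide +kernel

end Summit.BirchSwinnertonDyer.BirchSwinnertonDyer.Rank2Observatory
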